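import Mathlib
import Literature.Analysis.FluidPDE.Tao2016AveragedNS.RenormalisedCascadeWaves
import Literature.Analysis.FluidPDE.Tao2016AveragedNS.SelfSimilarCascadeBlowup
import Literature.Analysis.FluidPDE.Tao2016AveragedNS.ViscousEternalSolutions
import Literature.Analysis.FluidPDE.Tao2016AveragedNS.BoundedEternalSolutions
import Summits.NavierStokesRegularity.NavierStokesRegularity.Theses.TaoLadderRungTwoBreak
import Summits.NavierStokesRegularity.NavierStokesRegularity.Theorems.TaoLadderRungTwoBreakNoSurvivingEternalViscBddOneClassicalForm
import Summits.NavierStokesRegularity.NavierStokesRegularity.Theorems.TaoLadderRungTwoBreakNoSurvivingEternalViscBddOneClassicalFormChildren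
import Summits.NavierStokesRegularity.NavierStokesRegularity.Theorems.WakeRatchetAdmissibleEternalBoundCritical
import Summits.NavierStokesRegularity.NavierStokesRegularity.Theorems.WakeRatchetAdmissibleEternalBoundTerminal

/-!
# Crux `TaoLadderRungTwoBreak.EternalRigidityViscBddOne` (stmt-NavierStokesRegularity-20420) IN CLASSICAL FORM, and
# the route's deciding pair as ONE classical dichotomy

MODEL lattice ODEs only (Tao 2016 §4, §6.4); nothing in this file is a statement about the Navier–Stokes equations,
and no stub, crux, rung or summit is proved by it.

With the critical-variable dictionary of `…ClassicalForm` / `…ClassicalFormChildren` (this hand):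

* `crit_embed_eq` — the critical variable of the embedded solution `W_n(σ) = e^{-σ} • V_n(0 − e^{-σ})` is `V` on `t < 0`;
* `eternalRigidityViscBdd_iff_classical` — `EternalRigidityViscBdd R a` ⟺ «below a threshold, every E₂(R) table with
  ROBUST BLOW-UP from a one-shell datum (`NoGlobalCascade`, unchanged) carries, for some `ν̂ ≥ 0`, a solution of the
  autonomous lattice (crit) on `t < 0` with the type-I bound, uniformly integrable shells, shells bounded near `0⁻`,
  and (surv)»; BY NAME `eternalRigidityViscBddOne_iff_classical`;
* `target_of_classical_pair` — the route's deciding theorem re-read: the classical Liouville statement (no type-I ancient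
  solution of (crit) with (surv)) and the classical rigidity statement (robust blow-up produces one) together give
  `TaoLadderRungTwoBreak.Target` (via the tree's `closes`-glue `noRobustBlowupBelow_of_eternalViscBdd`).

HONEST LABEL: dictionary work; ⟨20419⟩, ⟨20420⟩, the Target and every NS statement remain OPEN.
-/

noncomputable section

-- the summit and its single sub-problem share the name (CONVENTIONS §1)
set_option linter.dupNamespace false

namespace Summit.NavierStokesRegularity.NavierStokesRegularity.Theorems.NoSurvivingEternalViscBddOne.ClassicalForm

open Filter Topology Set MeasureTheory
open Literature.Analysis.FluidPDE Literature.Analysis.FluidPDE.TaoCascade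
open Summit.NavierStokesRegularity.NavierStokesRegularity.Theses.TaoLadderRungTwoBreak
open Summit.NavierStokesRegularity.NavierStokesRegularity.Theorems.WakeRatchetTerminal
  (hasDerivAt_crit_visc exists_norm_crit_le)

variable {m : ℕ} {ε₀ νh a : ℝ} {α : Fin m → Fin m → Fin m → ℤ × ℤ × ℤ → ℝ}

/-- The critical variable of the embedded solution is `V` itself on `t < 0`. [elementary] -/
theorem crit_embed_eq (V : ℤ → ℝ → Em m) (n : ℤ) {t : ℝ} (ht : t < 0) :
    (-t)⁻¹ • (Real.exp (-(-Real.log (-t))) • V n (0 - Real.exp (-(-Real.log (-t))))) = V n t := by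
  have hnt : 0 < -t := neg_pos.2 ht
  rw [neg_neg, Real.exp_log hnt, smul_smul, inv_mul_cancel₀ hnt.ne', one_smul]
  congr 1
  ring

/-- **`EternalRigidityViscBdd R a` IN CLASSICAL FORM (exact).**  Robust blow-up below the threshold forces, for some
`ν̂ ≥ 0`, a type-I solution of the autonomous lattice (crit) on `t < 0` with uniformly integrable shells, shells bounded
near `0⁻`, and (surv) — and conversely.
[cite: Tao2016AveragedNS, §4 Thm. 4.2 (statement shape) and the viscous equation before it, §6.4; this file] -/
theorem eternalRigidityViscBdd_iff_classical (R a : ℝ) :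
    EternalRigidityViscBdd R a ↔
    ∃ εs : ℝ, 0 < εs ∧ ∀ ε₀ : ℝ, 0 < ε₀ → ε₀ ≤ εs →
      ∀ (α : Fin 4 → Fin 4 → Fin 4 → ℤ × ℤ × ℤ → ℝ) (X₀ : Fin 4 → ℝ), InTableClass R α →
        NoGlobalCascade ε₀ α X₀ →
          ∃ (νh : ℝ) (V : ℤ → ℝ → Em 4), 0 ≤ νh ∧
            (∀ (n : ℤ) (t : ℝ), t < 0 → HasDerivAt (V n)
              (tableQ α (V n t) + bigLam ε₀ • tableA α (V (n - 1) t)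
                + (bigLam ε₀)⁻¹ • tableB α (V (n + 1) t) (V n t)
                - (νh * (1 + ε₀) ^ ((2 : ℝ) * n)) • V n t) t) ∧
            (∃ C : ℝ, ∀ (n : ℤ) (t : ℝ), t < 0 → ‖V n t‖ ≤ C / (-t)) ∧
            (∃ M : ℝ, ∀ n : ℤ, IntegrableOn (fun t => ‖V n t‖) (Iio 0) ∧ ∫ t in Iio 0, ‖V n t‖ ≤ M) ∧
            (∀ n : ℤ, ∃ t₀ : ℝ, t₀ < 0 ∧ ∃ P : ℝ, ∀ t : ℝ, t₀ ≤ t → t < 0 → ‖V n t‖ ≤ P) ∧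
            (∃ c : ℝ, 0 < c ∧ ∀ N : ℕ, ∃ n : ℕ, N ≤ n ∧ ∃ t : ℝ, -Real.exp (-(N : ℝ)) ≤ t ∧ t < 0 ∧
                c ≤ physWeight a ε₀ ^ n * ‖V n t‖ ^ 2) := by
  constructor
  · rintro ⟨εs, hεs, H⟩
    refine ⟨εs, hεs, fun ε₀ hε₀ hle α X₀ hα hNG => ?_⟩
    obtain ⟨νh, W, hW, hU, hS⟩ := H ε₀ hε₀ hle α X₀ hα hNG
    exact ⟨νh, fun n t => (-t)⁻¹ • W n (-Real.log (-t)), hW.nonneg,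
      fun n t ht => hasDerivAt_crit_visc ht (hW.law n _), crit_typeI hU, crit_action hW,
      fun n => exists_norm_crit_le hW n, crit_surv_of_survivingFwd hS⟩
  · rintro ⟨εs, hεs, H⟩
    refine ⟨εs, hεs, fun ε₀ hε₀ hle α X₀ hα hNG => ?_⟩
    obtain ⟨νh, V, hν, hV, ⟨C, hC⟩, hact, hbd, hsurv⟩ := H ε₀ hε₀ hle α X₀ hα hNG
    refine ⟨νh, _, isEternalVisc_of_classical (ε₀ := ε₀) (α := α) hν hV hact hbd,
      uniformBound_of_classical (V := V) hC, survivingFwd_of_crit (a := a) (ε₀ := ε₀) ?_⟩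
    obtain ⟨c, hc, Hs⟩ := hsurv
    refine ⟨c, hc, fun N => ?_⟩
    obtain ⟨n, hn, t, htN, ht, hle'⟩ := Hs N
    refine ⟨n, hn, t, htN, ht, ?_⟩
    rw [crit_embed_eq V n ht]
    exact hle'

/-- **K2ᵛ(1) `EternalRigidityViscBddOne` IN CLASSICAL FORM (by name, exact).**
[cite: Tao2016AveragedNS, §4 Thm. 4.2 (statement shape), §6.4; this file] -/
theorem eternalRigidityViscBddOne_iff_classical :
    EternalRigidityViscBddOne ↔
    ∀ R : ℝ, 1 ≤ R → ∃ εs : ℝ, 0 < εs ∧ ∀ ε₀ : ℝ, 0 < ε₀ → ε₀ ≤ εs →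
      ∀ (α : Fin 4 → Fin 4 → Fin 4 → ℤ × ℤ × ℤ → ℝ) (X₀ : Fin 4 → ℝ), InTableClass R α →
        NoGlobalCascade ε₀ α X₀ →
          ∃ (νh : ℝ) (V : ℤ → ℝ → Em 4), 0 ≤ νh ∧
            (∀ (n : ℤ) (t : ℝ), t < 0 → HasDerivAt (V n)
              (tableQ α (V n t) + bigLam ε₀ • tableA α (V (n - 1) t)
                + (bigLam ε₀)⁻¹ • tableB α (V (n + 1) t) (V n t)
                - (νh * (1 + ε₀) ^ ((2 : ℝ) * n)) • V n t) t) ∧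
            (∃ C : ℝ, ∀ (n : ℤ) (t : ℝ), t < 0 → ‖V n t‖ ≤ C / (-t)) ∧
            (∃ M : ℝ, ∀ n : ℤ, IntegrableOn (fun t => ‖V n t‖) (Iio 0) ∧ ∫ t in Iio 0, ‖V n t‖ ≤ M) ∧
            (∀ n : ℤ, ∃ t₀ : ℝ, t₀ < 0 ∧ ∃ P : ℝ, ∀ t : ℝ, t₀ ≤ t → t < 0 → ‖V n t‖ ≤ P) ∧
            (∃ c : ℝ, 0 < c ∧ ∀ N : ℕ, ∃ n : ℕ, N ≤ n ∧ ∃ t : ℝ, -Real.exp (-(N : ℝ)) ≤ t ∧ t < 0 ∧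
                c ≤ physWeight 1 ε₀ ^ n * ‖V n t‖ ^ 2) :=
  ⟨fun h R hR => (eternalRigidityViscBdd_iff_classical R 1).1 (h R hR),
    fun h R hR => (eternalRigidityViscBdd_iff_classical R 1).2 (h R hR)⟩

/-- **The route's deciding pair as one classical dichotomy.**  If (i) below a threshold no E₂(R) table carries a
type-I solution of (crit) (`ν̂ ≥ 0`) with uniformly integrable shells, shells bounded near `0⁻` and (surv) at `a = 1`,
and (ii) below a threshold every robust blow-up produces one, then the rung leaf `Target` (no robust blow-up below a
threshold at any fixed spread) holds — the tree's glue `closes` read through the two classical forms.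
[cite: Tao2016AveragedNS, §4 Thm. 4.2 (statement shape), §6.4; tree `closes`] -/
theorem target_of_classical_pair
    (h₁ : ∀ R : ℝ, 1 ≤ R → ∃ εs : ℝ, 0 < εs ∧ ∀ ε₀ : ℝ, 0 < ε₀ → ε₀ ≤ εs →
      ∀ α : Fin 4 → Fin 4 → Fin 4 → ℤ × ℤ × ℤ → ℝ, InTableClass R α →
        ∀ νh : ℝ, 0 ≤ νh → ∀ V : ℤ → ℝ → Em 4,
          (∀ (n : ℤ) (t : ℝ), t < 0 → HasDerivAt (V n)
            (tableQ α (V n t) + bigLam ε₀ • tableA α (V (n - 1) t)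
              + (bigLam ε₀)⁻¹ • tableB α (V (n + 1) t) (V n t)
              - (νh * (1 + ε₀) ^ ((2 : ℝ) * n)) • V n t) t) →
          (∃ C : ℝ, ∀ (n : ℤ) (t : ℝ), t < 0 → ‖V n t‖ ≤ C / (-t)) →
          (∃ M : ℝ, ∀ n : ℤ, IntegrableOn (fun t => ‖V n t‖) (Iio 0) ∧ ∫ t in Iio 0, ‖V n t‖ ≤ M) →
          (∀ n : ℤ, ∃ t₀ : ℝ, t₀ < 0 ∧ ∃ P : ℝ, ∀ t : ℝ, t₀ ≤ t → t < 0 → ‖V n t‖ ≤ P) →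
            ¬ ∃ c : ℝ, 0 < c ∧ ∀ N : ℕ, ∃ n : ℕ, N ≤ n ∧ ∃ t : ℝ, -Real.exp (-(N : ℝ)) ≤ t ∧ t < 0 ∧
                c ≤ physWeight 1 ε₀ ^ n * ‖V n t‖ ^ 2)
    (h₂ : ∀ R : ℝ, 1 ≤ R → ∃ εs : ℝ, 0 < εs ∧ ∀ ε₀ : ℝ, 0 < ε₀ → ε₀ ≤ εs →
      ∀ (α : Fin 4 → Fin 4 → Fin 4 → ℤ × ℤ × ℤ → ℝ) (X₀ : Fin 4 → ℝ), InTableClass R α →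
        NoGlobalCascade ε₀ α X₀ →
          ∃ (νh : ℝ) (V : ℤ → ℝ → Em 4), 0 ≤ νh ∧
            (∀ (n : ℤ) (t : ℝ), t < 0 → HasDerivAt (V n)
              (tableQ α (V n t) + bigLam ε₀ • tableA α (V (n - 1) t)
                + (bigLam ε₀)⁻¹ • tableB α (V (n + 1) t) (V n t)
                - (νh * (1 + ε₀) ^ ((2 : ℝ) * n)) • V n t) t) ∧
            (∃ C : ℝ, ∀ (n : ℤ) (t : ℝ), t < 0 → ‖V n t‖ ≤ C / (-t)) ∧
            (∃ M : ℝ, ∀ n : ℤ, IntegrableOn (fun t => ‖V n t‖) (Iio 0) ∧ ∫ t in Iio 0, ‖V n t‖ ≤ M) ∧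
            (∀ n : ℤ, ∃ t₀ : ℝ, t₀ < 0 ∧ ∃ P : ℝ, ∀ t : ℝ, t₀ ≤ t → t < 0 → ‖V n t‖ ≤ P) ∧
            (∃ c : ℝ, 0 < c ∧ ∀ N : ℕ, ∃ n : ℕ, N ≤ n ∧ ∃ t : ℝ, -Real.exp (-(N : ℝ)) ≤ t ∧ t < 0 ∧
                c ≤ physWeight 1 ε₀ ^ n * ‖V n t‖ ^ 2)) :
    Target :=
  closes (noSurvivingEternalViscBddOne_of_classical h₁) (eternalRigidityViscBddOne_iff_classical.2 h₂)

end Summit.NavierStokesRegularity.NavierStokesRegularity.Theorems.NoSurvivingEternalViscBddOne.ClassicalForm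

end
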